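import Mathlib
import Summits.AtomisticToContinuum.Crystallization.Theses.PalmUnimodularRigidity
import Literature.MathematicalPhysics.StatisticalMechanics.BarlowStackingEnergy

/-!
# Sketch — first lemmas for the crux ideas on `LayeredLawsSelectHcp` (stmt-AtomisticToContinuum-9226)

Planner scratch (crux-ideate, round 1, ideator 2). Nothing here is a route item; these are the
"First lemma" signatures of the idea cards, checked to elaborate.
-/

noncomputable section

namespace Summit.AtomisticToContinuum.Crystallization.Cruxes.LayeredLawsSelectHcp.Sketch

open scoped BigOperators
open MeasureTheory Literature.MathematicalPhysics.StatisticalMechanics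

abbrev E3 := EuclideanSpace ℝ (Fin 3)

/-! ## Card A — stacking-blind coercivity transfer: the bilayer slab form -/

/-- Second derivative of the radial pair energy `x ↦ V ‖x‖` at the relative position `r`, as a
quadratic form in the relative displacement `v`. -/
def pairHess (V : ℝ → ℝ) (r v : E3) : ℝ :=
  iteratedFDeriv ℝ 2 (fun x : E3 => V ‖x‖) r ![v, v]

/-- The short part of Lennard-Jones: cut off (sharply, for the statement) at `rc`. -/
def ljShort (rc : ℝ) (r : ℝ) : ℝ := if r ≤ rc then lennardJones r else 0

/-- Sites of the ideal bilayer slab: layer `0` (letter `A`, height `0`) and layer `1`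
(letter `B`, height `h`); `layerVec a h δ k i j = i u + j v + δ w + k h e₃`. -/
def slabPos (a h : ℝ) (p : Fin 2 × ℤ × ℤ) : E3 :=
  layerVec a h (p.1 : ℤ) (p.1 : ℤ) p.2.1 p.2.2

/-- Pair weight in the slab functional: in-layer pairs are shared between the two slabs containing
the layer (weight `1/2`), cross pairs belong to this slab (weight `1`). -/
def slabWeight (p q : Fin 2 × ℤ × ℤ) : ℝ := if p.1 = q.1 then 1 / 2 else 1

/-- The harmonic slab form `Q_slab(u) = ½ Σ_{p ≠ q} w(p,q) · ½ D²V_s(p − q)[u_p − u_q]²` on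
finitely supported displacement fields of the bilayer (a `finsum` over ordered pairs; only pairs
meeting the support of `u` contribute). -/
def slabForm (a h rc : ℝ) (u : Fin 2 × ℤ × ℤ → E3) : ℝ :=
  (1 / 2) * ∑ᶠ pq : (Fin 2 × ℤ × ℤ) × (Fin 2 × ℤ × ℤ),
    if pq.1 = pq.2 then 0 else
      slabWeight pq.1 pq.2 * ((1 / 2) *
        pairHess (ljShort rc) (slabPos a h pq.1 - slabPos a h pq.2) (u pq.1 - u pq.2))

/-- The nearest-neighbour bond-stretch seminorm of the slab (the nine bonds per site of length
`≤ 11a/10`: six in-layer, three across). -/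
def slabStretch (a h : ℝ) (u : Fin 2 × ℤ × ℤ → E3) : ℝ :=
  ∑ᶠ pq : (Fin 2 × ℤ × ℤ) × (Fin 2 × ℤ × ℤ),
    if pq.1 ≠ pq.2 ∧ dist (slabPos a h pq.1) (slabPos a h pq.2) ≤ 11 / 10 * a then
      (inner ℝ (u pq.1 - u pq.2)
        ((dist (slabPos a h pq.1) (slabPos a h pq.2))⁻¹ • (slabPos a h pq.1 - slabPos a h pq.2))) ^ 2
    else 0

/-- **First lemma of card A (bilayer slab coercivity, to be CERTIFIED):** at the relaxed hcp
parameters (any `(a,h)` in the small box around `(0.9712, 0.793)`) and cut-off `rc = 37/25`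
(between the second shell `√2·a` and `0.99 · 2h`), the slab form of the short part of
Lennard-Jones dominates `λ ·` (bond-stretch seminorm) on finitely supported displacement fields,
with ONE constant `λ` — the same for every Barlow word, because every word is a union of congruent
slabs (`ShortRangeStackingBlindness`). -/
def SlabCoercivity (lam : ℝ) : Prop :=
  0 < lam ∧ ∀ a h : ℝ, 96 / 100 ≤ a → a ≤ 98 / 100 → 81 / 100 * a ≤ h → h ≤ 83 / 100 * a →
    ∀ u : Fin 2 × ℤ × ℤ → E3, (Function.support u).Finite →
      lam * slabStretch a h u ≤ slabForm a h (37 / 25) u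

/-- **Corrected first lemma of card A (F1, after kit j008774):** the SHORT-part slab form (`rc = 37/25`) has tiny negative
Bloch eigenvalues at long wavelength (prestress of the isolated short-range bilayer), so the certificate is moved to the
FULL-RANGE bilayer slab — all intra-slab pairs up to radius `6` (still word-blind: only pairs at layer distance `≥ 2` see the
Hägg word; the tail beyond `6` is a separate `|V''| r²`-summable budget). Tested numerically by kit j010557. -/
def SlabCoercivityFull (lam : ℝ) : Prop :=
  0 < lam ∧ ∀ a h : ℝ, 96 / 100 ≤ a → a ≤ 98 / 100 → 81 / 100 * a ≤ h → h ≤ 83 / 100 * a →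
    ∀ u : Fin 2 × ℤ × ℤ → E3, (Function.support u).Finite →
      lam * slabStretch a h u ≤ slabForm a h 6 u

/-- Oriented bilayer slab: `σ = 1` puts layer `1` at letter offset `+w` (Hägg step `+1`), `σ = -1` at `−w` (step `−1`);
the two slabs are mirror images, and a Barlow word is exactly a sequence of these two slab orientations. -/
def slabPosO (σ : ℤ) (a h : ℝ) (p : Fin 2 × ℤ × ℤ) : E3 :=
  layerVec a h (σ * (p.1 : ℤ)) (p.1 : ℤ) p.2.1 p.2.2

/-- Oriented slab form (all intra-slab pairs up to radius `rc`, in-layer pairs weight `1/2`). -/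
def slabFormO (σ : ℤ) (a h rc : ℝ) (u : Fin 2 × ℤ × ℤ → E3) : ℝ :=
  (1 / 2) * ∑ᶠ pq : (Fin 2 × ℤ × ℤ) × (Fin 2 × ℤ × ℤ),
    if pq.1 = pq.2 then 0 else
      slabWeight pq.1 pq.2 * ((1 / 2) *
        pairHess (ljShort rc) (slabPosO σ a h pq.1 - slabPosO σ a h pq.2) (u pq.1 - u pq.2))

/-- Oriented nearest-neighbour stretch form (in-layer pairs weight `1/2`, so that slabs assemble to the full stretch form). -/
def slabStretchO (σ : ℤ) (a h : ℝ) (u : Fin 2 × ℤ × ℤ → E3) : ℝ :=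
  ∑ᶠ pq : (Fin 2 × ℤ × ℤ) × (Fin 2 × ℤ × ℤ),
    if pq.1 ≠ pq.2 ∧ dist (slabPosO σ a h pq.1) (slabPosO σ a h pq.2) ≤ 11 / 10 * a then
      slabWeight pq.1 pq.2 * (inner ℝ (u pq.1 - u pq.2)
        ((dist (slabPosO σ a h pq.1) (slabPosO σ a h pq.2))⁻¹ •
          (slabPosO σ a h pq.1 - slabPosO σ a h pq.2))) ^ 2
    else 0

/-- **Corrected first lemma of card A after kit j008774 + j010557 (LAYER-TRANSFER CERTIFICATE).** No single slab form is
PSD (the isolated bilayer, short- or full-range, is long-wave unstable by −0.09·|k|² resp. −0.044·|k|² in one transverse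
branch: prestress), but the ASSEMBLED short part of every sampled word is coercive with the same constant (λ_short ≈ 1.92,
no failure down to |k| = BZ/192). The word-free certificate that explains this is a STORAGE FUNCTIONAL `p` on single-layer
fields, passed from layer to layer (a Kalman–Yakubovich–Popov / dissipation-inequality shape): for BOTH slab orientations,
slab form + p(lower layer) − p(upper layer) ≥ λ · stretch. Summing over the slabs of ANY word telescopes `p` away and gives
λ·(total stretch) ≤ (total short-range second variation), uniformly in the word. -/
def LayerTransferCertificate (lam : ℝ) : Prop :=
  0 < lam ∧ ∀ a h : ℝ, 96 / 100 ≤ a → a ≤ 98 / 100 → 81 / 100 * a ≤ h → h ≤ 83 / 100 * a →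
    ∃ p : (ℤ × ℤ → E3) → ℝ, ∀ σ : ℤ, (σ = 1 ∨ σ = -1) →
      ∀ u : Fin 2 × ℤ × ℤ → E3, (Function.support u).Finite →
        lam * slabStretchO σ a h u ≤
          slabFormO σ a h 6 u + p (fun ij => u (0, ij)) - p (fun ij => u (1, ij))

/-! ## Card B — mass-transport calibration: the letter current and the Palm glue -/

/-- **First lemma of card B (Hägg domination as a bounded shift-covariant CURRENT):** under the
sign + half-domination hypothesis of `LjRegistryDomination` (stmt-3063), the Peierls count of
stmt-0737 can be written pointwise: there is a bounded transfer `t s m` (energy passed from layer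
`m − 1` to layer `m`), covariant under the layer shift, such that at EVERY layer of EVERY Hägg
word the local stacking energy plus the net current is at least the hcp value plus the fault
price `|J₂|/2`. (Construction: `t s m = sup_{i ≤ m} Σ_{l ∈ [i,m)} (target_l − local_l)`, bounded by
`2 Σ k|J_k|` by 0737 applied to all windows.) -/
def HaggDominationCurrent : Prop :=
  ∀ J : ℕ → ℝ, Summable (fun k : ℕ => (k : ℝ) * |J k|) → J 2 < 0 →
    (∑' k : ℕ, (if 3 ≤ k then ((k : ℝ) - 1) * |J k| else 0)) ≤ |J 2| / 2 →
    ∃ t : (ℤ → ℤ) → ℤ → ℝ,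
      (∃ C : ℝ, ∀ s m, |t s m| ≤ C) ∧
      (∀ (s : ℤ → ℤ) (m : ℤ), t (fun i => s (i + 1)) m = t s (m + 1)) ∧
      ∀ s : ℤ → ℤ, IsHaggSeq s → ∀ m : ℤ,
        (∑' k : ℕ, (if 2 ≤ k ∧ Even k then J k else 0)) +
            |J 2| / 2 * (if s (m + 1) = s m then (1 : ℝ) else 0)
          ≤ haggLocalEnergy J s m + t s (m + 1) - t s m

/-- **Palm glue of card B (calibration kills defects):** on the frame of the crux (a δ-hard-core
rooted law `P` satisfying the Mecke / mass-transport identity), if an integrable transport kernel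
`g` calibrates the root energy pointwise — `m + κ·1_D(μ) ≤ h(μ) + Σ_y g(μ,y) − Σ_y g(θ_y μ, −y)`
for `P`-a.e. `μ` — and `P` is minimising (`E_P[h] ≤ m`), then the defect event `D` is `P`-null.
(Signed Mecke from the `ℝ≥0∞` one by integrability, then integrate the pointwise inequality.) -/
def CalibrationKillsDefects : Prop :=
  ∀ δ : ℝ, 0 < δ → ∀ P : Measure (Measure E3), IsProbabilityMeasure P →
    (∀ᵐ μ ∂P, ∃ S : Set E3, (0 : E3) ∈ S ∧ (∀ x ∈ S, ∀ y ∈ S, x ≠ y → δ ≤ dist x y) ∧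
      μ = (Measure.count : Measure E3).restrict S) →
    (∀ g : Measure E3 → E3 → ENNReal, Measurable (Function.uncurry g) →
      ∫⁻ μ, ∫⁻ y, g μ y ∂μ ∂P = ∫⁻ μ, ∫⁻ y, g (Measure.map (fun z => z - y) μ) (-y) ∂μ ∂P) →
    ∀ (D : Set (Measure E3)) (g : Measure E3 → E3 → ℝ) (m κ : ℝ), MeasurableSet D → 0 < κ →
      Measurable (Function.uncurry g) →
      (∫⁻ μ, ∫⁻ y, ‖g μ y‖ₑ ∂μ ∂P) ≠ ⊤ →
      (∫⁻ μ, ∫⁻ y, ‖g (Measure.map (fun z => z - y) μ) (-y)‖ₑ ∂μ ∂P) ≠ ⊤ →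
      (∀ᵐ μ ∂P, m + κ * D.indicator (fun _ => (1 : ℝ)) μ ≤
        (∫ y, lennardJones ‖y‖ ∂μ) / 2 + ∫ y, g μ y ∂μ -
          ∫ y, g (Measure.map (fun z => z - y) μ) (-y) ∂μ) →
      (∫ μ, (∫ y, lennardJones ‖y‖ ∂μ) / 2 ∂P) ≤ m →
      P D = 0

/-! ## (Not filed as a card — sibling crux 9225 already carries this lever; kept as the shared support S1's
pointwise cousin.) Palm first variation: minimising laws are supported on equilibria -/

/-- **Force balance of minimising point-stationary laws (cf. 9225's `ForceBalanceAS`):** if `P` is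
minimising among point-stationary hard-core laws in the sense that no bounded measurable
EQUIVARIANT displacement `v` (move every point `x` of `μ` by `v(θ_x μ)`) lowers the expected root
energy to first order, then the Lennard-Jones force on the root vanishes `P`-a.s. Stated as the
vanishing of the first variation in the direction of the force itself: `E_P[‖F(μ)‖²] = 0`, where
`F(μ) = Σ_{y ∈ μ, y ≠ 0} V'(‖y‖) y/‖y‖` (absolutely convergent under the hard core). -/
def rootForce (μ : Measure E3) : E3 :=
  ∫ y, (deriv lennardJones ‖y‖ * ‖y‖⁻¹) • y ∂μ

def FirstVariationVanishes : Prop :=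
  ∀ δ : ℝ, 0 < δ → ∀ P : Measure (Measure E3), IsProbabilityMeasure P →
    (∀ᵐ μ ∂P, ∃ S : Set E3, (0 : E3) ∈ S ∧ (∀ x ∈ S, ∀ y ∈ S, x ≠ y → δ ≤ dist x y) ∧
      μ = (Measure.count : Measure E3).restrict S) →
    (∀ g : Measure E3 → E3 → ENNReal, Measurable (Function.uncurry g) →
      ∫⁻ μ, ∫⁻ y, g μ y ∂μ ∂P = ∫⁻ μ, ∫⁻ y, g (Measure.map (fun z => z - y) μ) (-y) ∂μ ∂P) →
    -- minimality against equivariant first-order displacements `x ↦ x + ε v(θ_x μ)`: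
    (∀ v : Measure E3 → E3, Measurable v → (∃ C : ℝ, ∀ μ, ‖v μ‖ ≤ C) →
      0 ≤ ∫ μ, (∫ y, (deriv lennardJones ‖y‖ * ‖y‖⁻¹) *
        inner ℝ y (v (Measure.map (fun z => z - y) μ) - v μ) ∂μ) / 2 ∂P) →
    ∀ᵐ μ ∂P, rootForce μ = 0

end Summit.AtomisticToContinuum.Crystallization.Cruxes.LayeredLawsSelectHcp.Sketch
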